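import Mathlib.Data.Matrix.Mul
import Mathlib.LinearAlgebra.Matrix.DotProduct
import Mathlib.Data.Real.Basic
import Mathlib.Tactic.Linarith
import Mathlib.Tactic.LinearCombination
import Mathlib.Tactic.FieldSimp
import Mathlib.Tactic.Ring
import Mathlib.Tactic.Positivity
import HarnessLib

/-!
# Steepest descent on a quadratic: exact step, Kantorovich inequality, and the rate `((A-a)/(A+a))²`

Literature anchor for D. G. Luenberger and Y. Ye, *Linear and Nonlinear Programming*, 3rd ed.
(Springer, 2008) [LuenbergerYe2008], §7.6 "The method of steepest descent — the quadratic case":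
the quadratic objective (26) `f(x) = ½ xᵀQx - xᵀb`, the minimiser `Qx* = b` (27), the error function
`E(x) = ½ (x - x*)ᵀQ(x - x*)` (28) with `E = f + ½ x*ᵀQx*`, the gradient `g = Qx - b` (29), the
exact step `α_k = g_kᵀg_k / g_kᵀQg_k` (31) and the iteration (32), **Lemma 1** (33)
`E(x_{k+1}) = {1 - (g_kᵀg_k)² / [(g_kᵀQg_k)(g_kᵀQ⁻¹g_k)]} E(x_k)`, the **Kantorovich inequality** (34)
`(xᵀx)² / [(xᵀQx)(xᵀQ⁻¹x)] ≥ 4aA/(a+A)²`, and the **Theorem (steepest descent — quadratic case)**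
(35) `E(x_{k+1}) ≤ ((A-a)/(A+a))² E(x_k)`; held copy `book:luenberger2008-linear-nonlinear-programming`
pp. 214–217 read.  The same material is A. Antoniou and W.-S. Lu, *Practical Optimization* (2007)
[AntoniouLu2007], §5.2.3–5.2.5: orthogonality of successive steepest-descent directions, the
"line-search-free" step (5.4)–(5.7), and the convergence ratio (5.8)
`f(x_{k+1}) - f(x*) ≤ ((1-r)/(1+r))² [f(x_k) - f(x*)]`, `r = a/A` (stated there with a pointer to
Luenberger for the proof); held copy `book:antoniou2007-practical-optimization` pp. 87–89 read.

Conventions.  `Q : Matrix n n ℝ` symmetric; its inverse is carried as a matrix `C` with `Q * C = 1`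
(and `C * Q = 1`, `Cᵀ = C`) rather than `Q⁻¹`; "the eigenvalues of `Q` lie in `[a, A]`, `a > 0`" is
carried as the pair of quadratic-form bounds `a‖v‖² ≤ vᵀQv ≤ A‖v‖²` — all that the printed proofs
use.  The exact step is carried division-free as `α (gᵀQg) = gᵀg`.  The Kantorovich inequality is
proved here WITHOUT diagonalisation (the book diagonalises `Q`): from the form bounds one gets
`a‖Cv‖² ≤ vᵀCv`, `a vᵀCv ≤ ‖v‖²`, `‖v‖² ≤ A vᵀCv` by Cauchy–Schwarz for positive semidefinite forms,
then `vᵀQv + aA vᵀCv ≤ (a+A)‖v‖²` (the operator form `Q + aA Q⁻¹ ⪯ (a+A)I` of (34)) through the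
identity `(a+A)‖v‖² - vᵀQv - aA vᵀCv = ((Q-aI)v)ᵀ C ((AI-Q)v)`, and (34) follows by the AM–GM step.

## Main statements (all proved)

* `errE_eq_quadObj_add`, `errE_eq_quadObj_sub` — (28): `E = f + ½x*ᵀQx* = f - f(x*)`
  (with (29), (27): `g = Q(x - x*)`);
* `quadObj_line` — `f(x - αg) = f(x) - α gᵀg + ½α² gᵀQg` ((5.4), exact for a quadratic);
  `step_from_trial_value` — (5.6)–(5.7); `successive_gradients_orthogonal` — §5.2.3;
* `lemma1`, `two_errE_eq`, `lemma1_ratio` — **Lemma 1** (33) (division-free, and as printed);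
* `inv_form_lower`, `inv_form_upper`, `normSq_le_inv_form`, `kantorovich_operator`,
  `kantorovich` — the **Kantorovich inequality** (34) and the lemmas of its diagonalisation-free proof;
* `steepestDescent_rate` — the **Theorem** (35); `steepestDescent_rate_ratio` — AL07 (5.8) with
  `r = a/A`.

Related, not restated: the general strongly-convex gradient-method bound `f(x⁺) - p⋆ ≤ (1 - m/M)
(f(x) - p⋆)` (BV04 (9.18)) lives in `Literature.Analysis.Convex.StrongConvexityBounds`, the
steepest-descent directions for quadratic / `ℓ₁` norms (BV04 §9.4) in
`Literature.Analysis.Convex.SteepestDescent`, and the exact step on a line for a quadratic (AL07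
Theorem 6.3(b)) in `Literature.Analysis.Convex.ConjugateDirections`; the present file adds the
Kantorovich inequality and the sharper quadratic-case ratio `((A-a)/(A+a))²`, which none of them state.
-/

namespace Literature.Analysis.Convex.SteepestDescentQuadraticRate

open Matrix

variable {n : Type*} [Fintype n] [DecidableEq n]

/-! ### Folklore helpers: symmetric forms and Cauchy–Schwarz for a positive semidefinite form -/

omit [DecidableEq n] in
/-- `0 ≤ vᵀv`. [folklore] -/
@[folklore] private theorem dotSelf_nonneg (v : n → ℝ) : 0 ≤ v ⬝ᵥ v :=
  Finset.sum_nonneg fun i _ => mul_self_nonneg (v i)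

omit [DecidableEq n] in
/-- For symmetric `M`, `vᵀMw = wᵀMv`. [folklore] -/
@[folklore] private theorem form_comm {M : Matrix n n ℝ} (hM : Mᵀ = M) (v w : n → ℝ) :
    v ⬝ᵥ M *ᵥ w = w ⬝ᵥ M *ᵥ v := by
  rw [dotProduct_mulVec v M w, ← mulVec_transpose, hM]
  exact dotProduct_comm _ _

omit [DecidableEq n] in
/-- Cauchy–Schwarz for a symmetric positive semidefinite form: `(xᵀMy)² ≤ (xᵀMx)(yᵀMy)`.
[folklore] -/
@[folklore] private theorem form_cauchySchwarz {M : Matrix n n ℝ} (hM : Mᵀ = M)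
    (hpsd : ∀ v, 0 ≤ v ⬝ᵥ M *ᵥ v) (x y : n → ℝ) :
    (x ⬝ᵥ M *ᵥ y) ^ 2 ≤ (x ⬝ᵥ M *ᵥ x) * (y ⬝ᵥ M *ᵥ y) := by
  set p := y ⬝ᵥ M *ᵥ y with hp
  set q := x ⬝ᵥ M *ᵥ y with hq
  set r := x ⬝ᵥ M *ᵥ x with hr
  have hyx : y ⬝ᵥ M *ᵥ x = q := form_comm hM y x
  -- expansion of the form on `s • x + t • y`
  have hexp : ∀ s t : ℝ, (s • x + t • y) ⬝ᵥ M *ᵥ (s • x + t • y) =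
      s ^ 2 * r + 2 * s * t * q + t ^ 2 * p := by
    intro s t
    simp only [mulVec_add, mulVec_smul, add_dotProduct, dotProduct_add, smul_dotProduct,
      dotProduct_smul, smul_eq_mul]
    rw [hyx]
    ring
  rcases lt_or_ge 0 p with hp0 | hp0
  · -- `0 ≤ (p x - q y)ᵀM(p x - q y) = p (p r - q²)`
    have h := hpsd (p • x + (-q) • y)
    rw [hexp] at h
    have h' : 0 ≤ p * (p * r - q ^ 2) := by nlinarith [h]
    have h'' : 0 ≤ p * r - q ^ 2 := by
      by_contra hc
      rw [not_le] at hc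
      nlinarith [mul_neg_of_pos_of_neg hp0 hc]
    nlinarith [h'']
  · -- `p = 0`: then `q = 0`, else `r - 2tq < 0` for a suitable `t`
    have hp00 : p = 0 := le_antisymm hp0 (hpsd y)
    have hq0 : q = 0 := by
      by_contra hq0
      have h := hpsd ((1 : ℝ) • x + (-(r + 1) / (2 * q)) • y)
      rw [hexp, hp00] at h
      have : (1 : ℝ) ^ 2 * r + 2 * 1 * (-(r + 1) / (2 * q)) * q = -1 := by
        field_simp
        ring
      linarith
    rw [hq0, hp00]
    nlinarith [hpsd x]

/-! ### The quadratic problem (26)–(29) -/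

/-- The quadratic objective (26): `f(x) = ½ xᵀQx - xᵀb`. [cite: LuenbergerYe2008, §7.6 (26)] -/
noncomputable def quadObj (Q : Matrix n n ℝ) (b x : n → ℝ) : ℝ :=
  (1 / 2) * (x ⬝ᵥ Q *ᵥ x) - x ⬝ᵥ b

/-- The error function (28): `E(x) = ½ (x - x*)ᵀQ(x - x*)`. [cite: LuenbergerYe2008, §7.6 (28)] -/
noncomputable def errE (Q : Matrix n n ℝ) (xs x : n → ℝ) : ℝ :=
  (1 / 2) * ((x - xs) ⬝ᵥ Q *ᵥ (x - xs))

section Quadratic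

variable {Q : Matrix n n ℝ} {b xs : n → ℝ}

omit [DecidableEq n] in
/-- **(28): `E(x) = f(x) + ½ x*ᵀQx*`** ("the function `E` differs from `f` only by a constant"), for
symmetric `Q` and `Qx* = b` (27). [cite: LuenbergerYe2008, §7.6 (27)-(28)] -/
theorem errE_eq_quadObj_add (hQ : Qᵀ = Q) (hxs : Q *ᵥ xs = b) (x : n → ℝ) :
    errE Q xs x = quadObj Q b x + (1 / 2) * (xs ⬝ᵥ Q *ᵥ xs) := by
  have h1 : x ⬝ᵥ Q *ᵥ xs = x ⬝ᵥ b := by rw [hxs]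
  have h2 : xs ⬝ᵥ Q *ᵥ x = x ⬝ᵥ b := by rw [form_comm hQ xs x, hxs]
  simp only [errE, quadObj, mulVec_sub, dotProduct_sub, sub_dotProduct]
  linarith

omit [DecidableEq n] in
/-- Hence **`E(x) = f(x) - f(x*)`** (since `f(x*) = -½ x*ᵀQx*`) — the quantity bounded in AL07 (5.8).
[cite: LuenbergerYe2008, §7.6 (27)-(28); AntoniouLu2007, §5.2.5 (5.8)] -/
theorem errE_eq_quadObj_sub (hQ : Qᵀ = Q) (hxs : Q *ᵥ xs = b) (x : n → ℝ) :
    errE Q xs x = quadObj Q b x - quadObj Q b xs := by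
  have h0 : errE Q xs xs = 0 := by simp [errE]
  have h1 := errE_eq_quadObj_add hQ hxs x
  have h2 := errE_eq_quadObj_add hQ hxs xs
  linarith

omit [DecidableEq n] in
/-- (29) with (27): `g = Qx - b = Q(x - x*)` (the `y_k`, `g_k = Qy_k` of the proof of Lemma 1).
[cite: LuenbergerYe2008, §7.6 (27), (29), proof of Lemma 1] -/
private theorem grad_eq_mulVec_err (hxs : Q *ᵥ xs = b) (x : n → ℝ) :
    Q *ᵥ x - b = Q *ᵥ (x - xs) := by
  rw [mulVec_sub, hxs]

omit [DecidableEq n] in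
/-- **`f` along the negative gradient** (AL07 (5.4), exact here since `f` is quadratic; the
computation giving (31)): `f(x - αg) = f(x) - α gᵀg + ½ α² gᵀQg` with `g = Qx - b`.
[cite: AntoniouLu2007, §5.2.4 (5.3)-(5.5); LuenbergerYe2008, §7.6 (30)-(31)] -/
theorem quadObj_line (hQ : Qᵀ = Q) (x : n → ℝ) (α : ℝ) :
    quadObj Q b (x - α • (Q *ᵥ x - b)) =
      quadObj Q b x - α * ((Q *ᵥ x - b) ⬝ᵥ (Q *ᵥ x - b)) +
        (1 / 2) * α ^ 2 * ((Q *ᵥ x - b) ⬝ᵥ Q *ᵥ (Q *ᵥ x - b)) := by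
  set g := Q *ᵥ x - b with hg
  have hs : x ⬝ᵥ Q *ᵥ g = g ⬝ᵥ Q *ᵥ x := form_comm hQ x g
  have hgx : g ⬝ᵥ Q *ᵥ x = g ⬝ᵥ g + g ⬝ᵥ b := by
    rw [hg, ← dotProduct_add, sub_add_cancel]
  simp only [quadObj, mulVec_sub, mulVec_smul, dotProduct_sub, sub_dotProduct, dotProduct_smul,
    smul_dotProduct, smul_eq_mul]
  rw [hs, hgx]
  ring

omit [DecidableEq n] in
/-- **AL07 (5.6)–(5.7): the step from one trial function value.** If `f̂ = f(x - α̂ g)` then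
`α̂² gᵀQg = 2(f̂ - f + α̂ gᵀg)` (5.6), so the exact step `α (gᵀQg) = gᵀg` satisfies
`α · 2(f̂ - f + α̂ gᵀg) = gᵀg α̂²` (5.7) — exactly, for a quadratic. [cite: AntoniouLu2007, §5.2.4 (5.6)-(5.7)] -/
theorem step_from_trial_value (hQ : Qᵀ = Q) (x : n → ℝ) {αh α fh : ℝ}
    (hfh : fh = quadObj Q b (x - αh • (Q *ᵥ x - b)))
    (hα : α * ((Q *ᵥ x - b) ⬝ᵥ Q *ᵥ (Q *ᵥ x - b)) = (Q *ᵥ x - b) ⬝ᵥ (Q *ᵥ x - b)) :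
    αh ^ 2 * ((Q *ᵥ x - b) ⬝ᵥ Q *ᵥ (Q *ᵥ x - b)) =
        2 * (fh - quadObj Q b x + αh * ((Q *ᵥ x - b) ⬝ᵥ (Q *ᵥ x - b))) ∧
      α * (2 * (fh - quadObj Q b x + αh * ((Q *ᵥ x - b) ⬝ᵥ (Q *ᵥ x - b)))) =
        ((Q *ᵥ x - b) ⬝ᵥ (Q *ᵥ x - b)) * αh ^ 2 := by
  have h := quadObj_line (b := b) hQ x αh
  rw [← hfh] at h
  constructor
  · linarith
  · have h56 : 2 * (fh - quadObj Q b x + αh * ((Q *ᵥ x - b) ⬝ᵥ (Q *ᵥ x - b))) =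
        αh ^ 2 * ((Q *ᵥ x - b) ⬝ᵥ Q *ᵥ (Q *ᵥ x - b)) := by linarith
    rw [h56, mul_left_comm, hα, mul_comm]

omit [DecidableEq n] in
/-- **AL07 §5.2.3: successive steepest-descent directions are orthogonal.** With the exact step
`α (gᵀQg) = gᵀg` the new gradient `g' = Q(x - αg) - b = g - αQg` satisfies `g'ᵀg = 0`, i.e.
`d_{k+1}ᵀd_k = 0`. [cite: AntoniouLu2007, §5.2.3; LuenbergerYe2008, §7.6 (31)-(32)] -/
theorem successive_gradients_orthogonal (x : n → ℝ) {α : ℝ}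
    (hα : α * ((Q *ᵥ x - b) ⬝ᵥ Q *ᵥ (Q *ᵥ x - b)) = (Q *ᵥ x - b) ⬝ᵥ (Q *ᵥ x - b)) :
    (Q *ᵥ (x - α • (Q *ᵥ x - b)) - b) ⬝ᵥ (Q *ᵥ x - b) = 0 := by
  have hg' : Q *ᵥ (x - α • (Q *ᵥ x - b)) - b = (Q *ᵥ x - b) - α • Q *ᵥ (Q *ᵥ x - b) := by
    rw [mulVec_sub, mulVec_smul, sub_right_comm]
  rw [hg', sub_dotProduct, smul_dotProduct, smul_eq_mul, dotProduct_comm (Q *ᵥ (Q *ᵥ x - b)),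
    hα, sub_self]

/-! ### Lemma 1 (33) -/

omit [DecidableEq n] in
/-- **Lemma 1 (33), division-free.** For symmetric `Q`, `Qx* = b`, `g = Qx - b`, the exact step
`α (gᵀQg) = gᵀg` and `x' = x - αg`: `2 (gᵀQg) E(x') = 2 (gᵀQg) E(x) - (gᵀg)²`.
[cite: LuenbergerYe2008, §7.6 Lemma 1 (33)] -/
theorem lemma1 (hQ : Qᵀ = Q) (hxs : Q *ᵥ xs = b) (x : n → ℝ) {α : ℝ}
    (hα : α * ((Q *ᵥ x - b) ⬝ᵥ Q *ᵥ (Q *ᵥ x - b)) = (Q *ᵥ x - b) ⬝ᵥ (Q *ᵥ x - b)) :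
    2 * ((Q *ᵥ x - b) ⬝ᵥ Q *ᵥ (Q *ᵥ x - b)) * errE Q xs (x - α • (Q *ᵥ x - b)) =
      2 * ((Q *ᵥ x - b) ⬝ᵥ Q *ᵥ (Q *ᵥ x - b)) * errE Q xs x -
        ((Q *ᵥ x - b) ⬝ᵥ (Q *ᵥ x - b)) ^ 2 := by
  set g := Q *ᵥ x - b with hg
  set y := x - xs with hy
  have hgy : Q *ᵥ y = g := by rw [hy, hg, grad_eq_mulVec_err hxs]
  -- `2E(x') = 2E(x) - 2α gᵀg + α² gᵀQg`
  have hgQy : g ⬝ᵥ Q *ᵥ y = g ⬝ᵥ g := by rw [hgy]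
  have hs : y ⬝ᵥ Q *ᵥ g = g ⬝ᵥ g := by rw [form_comm hQ y g, hgQy]
  have hy' : x - α • g - xs = y - α • g := by rw [hy, sub_right_comm]
  have e1 : errE Q xs (x - α • g) = (1 / 2) * ((y - α • g) ⬝ᵥ Q *ᵥ (y - α • g)) := by
    simp only [errE, hy']
  have e2 : errE Q xs x = (1 / 2) * (y ⬝ᵥ Q *ᵥ y) := by
    simp only [errE, hy]
  have e3 : (y - α • g) ⬝ᵥ Q *ᵥ (y - α • g) =
      y ⬝ᵥ Q *ᵥ y - 2 * α * (g ⬝ᵥ g) + α ^ 2 * (g ⬝ᵥ Q *ᵥ g) := by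
    simp only [mulVec_sub, mulVec_smul, sub_dotProduct, dotProduct_sub, smul_dotProduct,
      dotProduct_smul, smul_eq_mul]
    rw [hs, hgQy]
    ring
  have h1 : 2 * errE Q xs (x - α • g) =
      2 * errE Q xs x - 2 * α * (g ⬝ᵥ g) + α ^ 2 * (g ⬝ᵥ Q *ᵥ g) := by
    rw [e1, e2, e3]; ring
  linear_combination ((g ⬝ᵥ Q *ᵥ g)) * h1 + (α * (g ⬝ᵥ Q *ᵥ g) - g ⬝ᵥ g) * hα

/-- **`2E(x) = gᵀQ⁻¹g`** (the denominator of (33)): with `C = Q⁻¹` (`QC = CQ = 1`),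
`(x - x*)ᵀQ(x - x*) = gᵀCg`. [cite: LuenbergerYe2008, §7.6 proof of Lemma 1] -/
theorem two_errE_eq {C : Matrix n n ℝ} (hQC : Q * C = 1) (hCQ : C * Q = 1) (hxs : Q *ᵥ xs = b)
    (x : n → ℝ) : 2 * errE Q xs x = (Q *ᵥ x - b) ⬝ᵥ C *ᵥ (Q *ᵥ x - b) := by
  have hy : C *ᵥ (Q *ᵥ x - b) = x - xs := by
    rw [grad_eq_mulVec_err hxs, mulVec_mulVec, hCQ, one_mulVec]
  have h : (x - xs) ⬝ᵥ Q *ᵥ (x - xs) = (Q *ᵥ x - b) ⬝ᵥ C *ᵥ (Q *ᵥ x - b) := by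
    conv_lhs => rw [← hy, mulVec_mulVec, hQC, one_mulVec]
    exact dotProduct_comm _ _
  simp only [errE, h]
  ring

/-- **Lemma 1 (33), as printed:** when `gᵀQg ≠ 0` and `gᵀQ⁻¹g ≠ 0`,
`E(x_{k+1}) = {1 - (gᵀg)² / [(gᵀQg)(gᵀQ⁻¹g)]} E(x_k)`. [cite: LuenbergerYe2008, §7.6 Lemma 1 (33)] -/
theorem lemma1_ratio {C : Matrix n n ℝ} (hQ : Qᵀ = Q) (hQC : Q * C = 1) (hCQ : C * Q = 1)
    (hxs : Q *ᵥ xs = b) (x : n → ℝ) {α : ℝ}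
    (hα : α * ((Q *ᵥ x - b) ⬝ᵥ Q *ᵥ (Q *ᵥ x - b)) = (Q *ᵥ x - b) ⬝ᵥ (Q *ᵥ x - b))
    (hq : (Q *ᵥ x - b) ⬝ᵥ Q *ᵥ (Q *ᵥ x - b) ≠ 0) (hc : (Q *ᵥ x - b) ⬝ᵥ C *ᵥ (Q *ᵥ x - b) ≠ 0) :
    errE Q xs (x - α • (Q *ᵥ x - b)) =
      (1 - ((Q *ᵥ x - b) ⬝ᵥ (Q *ᵥ x - b)) ^ 2 /
          (((Q *ᵥ x - b) ⬝ᵥ Q *ᵥ (Q *ᵥ x - b)) * ((Q *ᵥ x - b) ⬝ᵥ C *ᵥ (Q *ᵥ x - b)))) *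
        errE Q xs x := by
  have h1 := lemma1 hQ hxs x hα
  have h2 := two_errE_eq hQC hCQ hxs x
  have hE : errE Q xs x = (Q *ᵥ x - b) ⬝ᵥ C *ᵥ (Q *ᵥ x - b) / 2 := by rw [← h2]; ring
  have h2q : (2 : ℝ) * ((Q *ᵥ x - b) ⬝ᵥ Q *ᵥ (Q *ᵥ x - b)) ≠ 0 := mul_ne_zero two_ne_zero hq
  have hE1 : errE Q xs (x - α • (Q *ᵥ x - b)) =
      (2 * ((Q *ᵥ x - b) ⬝ᵥ Q *ᵥ (Q *ᵥ x - b)) * errE Q xs x -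
        ((Q *ᵥ x - b) ⬝ᵥ (Q *ᵥ x - b)) ^ 2) / (2 * ((Q *ᵥ x - b) ⬝ᵥ Q *ᵥ (Q *ᵥ x - b))) := by
    rw [← h1]; field_simp
  rw [hE1, hE]
  field_simp

end Quadratic

/-! ### The Kantorovich inequality (34), without diagonalisation -/

section Kantorovich

variable {Q C : Matrix n n ℝ} {a A : ℝ}

/-- From `a‖v‖² ≤ vᵀQv` (applied at `Cv`): **`a‖Cv‖² ≤ vᵀCv`**; in particular `Q⁻¹ ⪰ 0`.
[cite: LuenbergerYe2008, §7.6 Kantorovich inequality (34), proof] -/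
theorem inv_form_lower (hQC : Q * C = 1) (ha : ∀ v, a * (v ⬝ᵥ v) ≤ v ⬝ᵥ Q *ᵥ v)
    (v : n → ℝ) : a * ((C *ᵥ v) ⬝ᵥ (C *ᵥ v)) ≤ v ⬝ᵥ C *ᵥ v := by
  have h := ha (C *ᵥ v)
  have e : (C *ᵥ v) ⬝ᵥ Q *ᵥ (C *ᵥ v) = v ⬝ᵥ C *ᵥ v := by
    rw [mulVec_mulVec, hQC, one_mulVec]; exact dotProduct_comm _ _
  rwa [e] at h

/-- **`a vᵀCv ≤ ‖v‖²`** (i.e. `Q⁻¹ ⪯ a⁻¹I`), from `a‖Cv‖² ≤ vᵀCv` and Cauchy–Schwarz.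
[cite: LuenbergerYe2008, §7.6 Kantorovich inequality (34), proof] -/
theorem inv_form_upper (hQC : Q * C = 1) (ha0 : 0 < a)
    (ha : ∀ v, a * (v ⬝ᵥ v) ≤ v ⬝ᵥ Q *ᵥ v) (v : n → ℝ) : a * (v ⬝ᵥ C *ᵥ v) ≤ v ⬝ᵥ v := by
  have hL := inv_form_lower hQC ha v
  have hc0 : 0 ≤ v ⬝ᵥ C *ᵥ v :=
    le_trans (mul_nonneg ha0.le (dotSelf_nonneg _)) hL
  -- Cauchy–Schwarz for the identity form: `(vᵀ(Cv))² ≤ ‖v‖² ‖Cv‖²`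
  have hCS := form_cauchySchwarz (M := (1 : Matrix n n ℝ)) transpose_one
    (fun w => by rw [one_mulVec]; exact dotSelf_nonneg _) v (C *ᵥ v)
  simp only [one_mulVec] at hCS
  -- `a c² ≤ a ‖v‖² ‖Cv‖² ≤ ‖v‖² c`
  have h1 : a * (v ⬝ᵥ C *ᵥ v) ^ 2 ≤ (v ⬝ᵥ v) * (v ⬝ᵥ C *ᵥ v) := by
    calc a * (v ⬝ᵥ C *ᵥ v) ^ 2 ≤ a * ((v ⬝ᵥ v) * (C *ᵥ v ⬝ᵥ C *ᵥ v)) :=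
          mul_le_mul_of_nonneg_left hCS ha0.le
      _ = (v ⬝ᵥ v) * (a * (C *ᵥ v ⬝ᵥ C *ᵥ v)) := by ring
      _ ≤ (v ⬝ᵥ v) * (v ⬝ᵥ C *ᵥ v) :=
          mul_le_mul_of_nonneg_left hL (dotSelf_nonneg _)
  rcases lt_or_eq_of_le hc0 with hpos | hzero
  · exact le_of_mul_le_mul_right (by nlinarith [h1]) hpos
  · rw [← hzero, mul_zero]; exact dotSelf_nonneg _

/-- **`‖v‖² ≤ A vᵀCv`** (i.e. `A⁻¹I ⪯ Q⁻¹`), from `vᵀQv ≤ A‖v‖²` and Cauchy–Schwarz in the `Q`-form.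
[cite: LuenbergerYe2008, §7.6 Kantorovich inequality (34), proof] -/
theorem normSq_le_inv_form (hQ : Qᵀ = Q) (hQC : Q * C = 1) (ha0 : 0 < a)
    (haA : a ≤ A) (ha : ∀ v, a * (v ⬝ᵥ v) ≤ v ⬝ᵥ Q *ᵥ v) (hA : ∀ v, v ⬝ᵥ Q *ᵥ v ≤ A * (v ⬝ᵥ v))
    (v : n → ℝ) : v ⬝ᵥ v ≤ A * (v ⬝ᵥ C *ᵥ v) := by
  have hpsd : ∀ w, 0 ≤ w ⬝ᵥ Q *ᵥ w :=
    fun w => le_trans (mul_nonneg ha0.le (dotSelf_nonneg _)) (ha w)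
  have hc0 : 0 ≤ v ⬝ᵥ C *ᵥ v :=
    le_trans (mul_nonneg ha0.le (dotSelf_nonneg _)) (inv_form_lower hQC ha v)
  -- `‖v‖² = vᵀQ(Cv)` and `(Cv)ᵀQ(Cv) = vᵀCv`
  have h1 : v ⬝ᵥ Q *ᵥ (C *ᵥ v) = v ⬝ᵥ v := by rw [mulVec_mulVec, hQC, one_mulVec]
  have h2 : (C *ᵥ v) ⬝ᵥ Q *ᵥ (C *ᵥ v) = v ⬝ᵥ C *ᵥ v := by
    rw [mulVec_mulVec, hQC, one_mulVec]; exact dotProduct_comm _ _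
  have hCS := form_cauchySchwarz hQ hpsd v (C *ᵥ v)
  rw [h1, h2] at hCS
  -- `‖v‖⁴ ≤ (vᵀQv)(vᵀCv) ≤ A‖v‖² vᵀCv`
  have h3 : (v ⬝ᵥ v) ^ 2 ≤ A * (v ⬝ᵥ v) * (v ⬝ᵥ C *ᵥ v) := by
    calc (v ⬝ᵥ v) ^ 2 ≤ (v ⬝ᵥ Q *ᵥ v) * (v ⬝ᵥ C *ᵥ v) := hCS
      _ ≤ A * (v ⬝ᵥ v) * (v ⬝ᵥ C *ᵥ v) := mul_le_mul_of_nonneg_right (hA v) hc0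
  rcases lt_or_eq_of_le (dotSelf_nonneg v) with hpos | hzero
  · have hpos' : 0 < v ⬝ᵥ v := hpos
    exact le_of_mul_le_mul_right (by nlinarith [h3]) hpos'
  · have hz : v ⬝ᵥ v = 0 := by simpa using hzero.symm
    rw [hz]; exact mul_nonneg (le_trans ha0.le haA) hc0

/-- **The operator form of (34): `vᵀQv + aA vᵀQ⁻¹v ≤ (a + A)‖v‖²`** (i.e. `Q + aA Q⁻¹ ⪯ (a+A)I`),
through `(a+A)‖v‖² - vᵀQv - aA vᵀCv = ((Q - aI)v)ᵀC((AI - Q)v)` and Cauchy–Schwarz for the form of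
`I - aC`. [cite: LuenbergerYe2008, §7.6 Kantorovich inequality (34)] -/
theorem kantorovich_operator (hQ : Qᵀ = Q) (hC : Cᵀ = C) (hQC : Q * C = 1) (hCQ : C * Q = 1)
    (ha0 : 0 < a) (haA : a ≤ A) (ha : ∀ v, a * (v ⬝ᵥ v) ≤ v ⬝ᵥ Q *ᵥ v)
    (hA : ∀ v, v ⬝ᵥ Q *ᵥ v ≤ A * (v ⬝ᵥ v)) (v : n → ℝ) :
    v ⬝ᵥ Q *ᵥ v + a * A * (v ⬝ᵥ C *ᵥ v) ≤ (a + A) * (v ⬝ᵥ v) := by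
  -- the form of `M = I - aC`: `xᵀMy = xᵀy - a xᵀCy`, symmetric and positive semidefinite
  set M : Matrix n n ℝ := 1 - a • C with hM
  have hMform : ∀ x y : n → ℝ, x ⬝ᵥ M *ᵥ y = x ⬝ᵥ y - a * (x ⬝ᵥ C *ᵥ y) := by
    intro x y
    rw [hM, sub_mulVec, one_mulVec, smul_mulVec, dotProduct_sub, dotProduct_smul, smul_eq_mul]
  have hMt : Mᵀ = M := by rw [hM, transpose_sub, transpose_one, transpose_smul, hC]
  have hMpsd : ∀ w, 0 ≤ w ⬝ᵥ M *ᵥ w := by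
    intro w; rw [hMform]; linarith [inv_form_upper hQC ha0 ha w]
  -- `u = (Q - aI)v`; `N = uᵀCu = vᵀMu`, `P = uᵀCv = vᵀMv`
  set u := Q *ᵥ v - a • v with hu
  have hQv_C : ∀ w, (Q *ᵥ v) ⬝ᵥ C *ᵥ w = v ⬝ᵥ w := by
    intro w
    rw [← form_comm hC, mulVec_mulVec, hCQ, one_mulVec, dotProduct_comm]
  have huC : ∀ w, u ⬝ᵥ C *ᵥ w = v ⬝ᵥ M *ᵥ w := by
    intro w
    rw [hu, sub_dotProduct, smul_dotProduct, smul_eq_mul, hQv_C, hMform]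
  have hN : u ⬝ᵥ C *ᵥ u = v ⬝ᵥ M *ᵥ u := huC u
  have hP : u ⬝ᵥ C *ᵥ v = v ⬝ᵥ M *ᵥ v := huC v
  -- the identity `(a+A)‖v‖² - vᵀQv - aA vᵀCv = (A - a) P - N`
  have hvCu : v ⬝ᵥ C *ᵥ u = u ⬝ᵥ C *ᵥ v := form_comm hC v u
  have hid : (a + A) * (v ⬝ᵥ v) - v ⬝ᵥ Q *ᵥ v - a * A * (v ⬝ᵥ C *ᵥ v) =
      (A - a) * (u ⬝ᵥ C *ᵥ v) - u ⬝ᵥ C *ᵥ u := by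
    have e1 : u ⬝ᵥ C *ᵥ v = v ⬝ᵥ v - a * (v ⬝ᵥ C *ᵥ v) := by rw [hP, hMform]
    have e2 : u ⬝ᵥ C *ᵥ u = v ⬝ᵥ Q *ᵥ v - 2 * a * (v ⬝ᵥ v) + a ^ 2 * (v ⬝ᵥ C *ᵥ v) := by
      have : u ⬝ᵥ C *ᵥ u = (Q *ᵥ v) ⬝ᵥ C *ᵥ u - a * (v ⬝ᵥ C *ᵥ u) := by
        rw [hu, sub_dotProduct, smul_dotProduct, smul_eq_mul]
      rw [this, hQv_C, hvCu, e1, hu, dotProduct_sub, dotProduct_smul, smul_eq_mul]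
      ring
    rw [e1, e2]; ring
  -- `MuMu ≤ (A - a) N` (from `‖u‖² ≤ A uᵀCu`) and Cauchy–Schwarz: `N² ≤ P · (A - a) N`
  have hMu : u ⬝ᵥ M *ᵥ u ≤ (A - a) * (u ⬝ᵥ C *ᵥ u) := by
    rw [hMform]; linarith [normSq_le_inv_form hQ hQC ha0 haA ha hA u]
  have hP0 : 0 ≤ u ⬝ᵥ C *ᵥ v := by rw [hP]; exact hMpsd v
  have hCS := form_cauchySchwarz hMt hMpsd v u
  rw [← hN, ← hP] at hCS
  have hN_le : u ⬝ᵥ C *ᵥ u ≤ (A - a) * (u ⬝ᵥ C *ᵥ v) := by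
    rcases lt_or_ge 0 (u ⬝ᵥ C *ᵥ u) with hNpos | hNnp
    · have h2 : (u ⬝ᵥ C *ᵥ u) ^ 2 ≤ (u ⬝ᵥ C *ᵥ v) * ((A - a) * (u ⬝ᵥ C *ᵥ u)) :=
        le_trans hCS (mul_le_mul_of_nonneg_left hMu hP0)
      exact le_of_mul_le_mul_right (by nlinarith [h2]) hNpos
    · exact le_trans hNnp (mul_nonneg (by linarith) hP0)
  linarith [hid, hN_le]

/-- **Kantorovich inequality (34):** for symmetric positive definite `Q` with `a‖v‖² ≤ vᵀQv ≤ A‖v‖²`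
(`0 < a ≤ A`) and `C = Q⁻¹`: `4aA (vᵀQv)(vᵀQ⁻¹v) ≤ (a + A)² (vᵀv)²`, i.e.
`(vᵀv)² / [(vᵀQv)(vᵀQ⁻¹v)] ≥ 4aA/(a+A)²`. [cite: LuenbergerYe2008, §7.6 Kantorovich inequality (34)] -/
theorem kantorovich (hQ : Qᵀ = Q) (hC : Cᵀ = C) (hQC : Q * C = 1) (hCQ : C * Q = 1) (ha0 : 0 < a)
    (haA : a ≤ A) (ha : ∀ v, a * (v ⬝ᵥ v) ≤ v ⬝ᵥ Q *ᵥ v)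
    (hA : ∀ v, v ⬝ᵥ Q *ᵥ v ≤ A * (v ⬝ᵥ v)) (v : n → ℝ) :
    4 * a * A * ((v ⬝ᵥ Q *ᵥ v) * (v ⬝ᵥ C *ᵥ v)) ≤ (a + A) ^ 2 * (v ⬝ᵥ v) ^ 2 := by
  have hK := kantorovich_operator hQ hC hQC hCQ ha0 haA ha hA v
  have hq0 : 0 ≤ v ⬝ᵥ Q *ᵥ v := le_trans (mul_nonneg ha0.le (dotSelf_nonneg _)) (ha v)
  have hc0 : 0 ≤ v ⬝ᵥ C *ᵥ v :=
    le_trans (mul_nonneg ha0.le (dotSelf_nonneg _)) (inv_form_lower hQC ha v)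
  have hA0 : 0 ≤ a * A := mul_nonneg ha0.le (le_trans ha0.le haA)
  -- AM–GM: `4 q (aA c) ≤ (q + aA c)² ≤ ((a+A)‖v‖²)²`
  have h1 : 0 ≤ v ⬝ᵥ Q *ᵥ v + a * A * (v ⬝ᵥ C *ᵥ v) := by positivity
  nlinarith [sq_nonneg (v ⬝ᵥ Q *ᵥ v - a * A * (v ⬝ᵥ C *ᵥ v)), mul_le_mul hK hK h1 (mul_nonneg (by linarith) (dotSelf_nonneg v))]

end Kantorovich

/-! ### The theorem (35) and AL07 (5.8) -/

section Rate

variable {Q C : Matrix n n ℝ} {b xs : n → ℝ} {a A : ℝ}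

/-- **Theorem (steepest descent — quadratic case), (35).** For symmetric `Q` with
`a‖v‖² ≤ vᵀQv ≤ A‖v‖²` (`0 < a ≤ A`), `C = Q⁻¹`, `Qx* = b`, and the steepest-descent step (32)
`x' = x - αg`, `g = Qx - b`, `α (gᵀQg) = gᵀg`: `E(x') ≤ ((A - a)/(A + a))² E(x)`.
[cite: LuenbergerYe2008, §7.6 Theorem (steepest descent, quadratic case) (35)] -/
theorem steepestDescent_rate (hQ : Qᵀ = Q) (hC : Cᵀ = C) (hQC : Q * C = 1) (hCQ : C * Q = 1)
    (ha0 : 0 < a) (haA : a ≤ A) (ha : ∀ v, a * (v ⬝ᵥ v) ≤ v ⬝ᵥ Q *ᵥ v)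
    (hA : ∀ v, v ⬝ᵥ Q *ᵥ v ≤ A * (v ⬝ᵥ v)) (hxs : Q *ᵥ xs = b) (x : n → ℝ) {α : ℝ}
    (hα : α * ((Q *ᵥ x - b) ⬝ᵥ Q *ᵥ (Q *ᵥ x - b)) = (Q *ᵥ x - b) ⬝ᵥ (Q *ᵥ x - b)) :
    errE Q xs (x - α • (Q *ᵥ x - b)) ≤ ((A - a) / (A + a)) ^ 2 * errE Q xs x := by
  set g := Q *ᵥ x - b with hg
  have h33 : 2 * (g ⬝ᵥ Q *ᵥ g) * errE Q xs (x - α • g) =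
      2 * (g ⬝ᵥ Q *ᵥ g) * errE Q xs x - (g ⬝ᵥ g) ^ 2 := lemma1 hQ hxs x hα
  have hE : 2 * errE Q xs x = g ⬝ᵥ C *ᵥ g := two_errE_eq hQC hCQ hxs x
  have h34 : 4 * a * A * ((g ⬝ᵥ Q *ᵥ g) * (g ⬝ᵥ C *ᵥ g)) ≤ (a + A) ^ 2 * (g ⬝ᵥ g) ^ 2 :=
    kantorovich hQ hC hQC hCQ ha0 haA ha hA g
  have hApos : 0 < A + a := by linarith
  have hq_lower : a * (g ⬝ᵥ g) ≤ g ⬝ᵥ Q *ᵥ g := ha g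
  rcases eq_or_lt_of_le (le_trans (mul_nonneg ha0.le (dotSelf_nonneg g)) hq_lower)
    with hq0 | hqpos
  · -- `gᵀQg = 0` forces `g = 0`: no move, and `E(x) = 0`
    have hgg : g ⬝ᵥ g = 0 := by
      have : a * (g ⬝ᵥ g) ≤ 0 := by rw [hq0]; exact hq_lower
      exact le_antisymm (by nlinarith [dotSelf_nonneg g]) (dotSelf_nonneg g)
    have hg0 : g = 0 := dotProduct_self_eq_zero.mp hgg
    have hE0 : errE Q xs x = 0 := by
      have : 2 * errE Q xs x = 0 := by rw [hE, hg0, zero_dotProduct]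
      linarith
    rw [hg0, smul_zero, sub_zero, hE0, mul_zero]
  · -- `2qE' = 2qE - s² ≤ 2qE (1 - 4aA/(a+A)²) = 2q ρ E`
    have hρ : 1 - ((A - a) / (A + a)) ^ 2 = 4 * a * A / (A + a) ^ 2 := by
      field_simp; ring
    have hE' : errE Q xs x = (g ⬝ᵥ C *ᵥ g) / 2 := by rw [← hE]; ring
    -- `s² ≥ (4aA/(a+A)²) q c`
    have hs : 4 * a * A / (A + a) ^ 2 * ((g ⬝ᵥ Q *ᵥ g) * (g ⬝ᵥ C *ᵥ g)) ≤ (g ⬝ᵥ g) ^ 2 := by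
      rw [div_mul_eq_mul_div, div_le_iff₀ (by positivity)]
      linarith [h34]
    have key : 2 * (g ⬝ᵥ Q *ᵥ g) * errE Q xs (x - α • g) ≤
        2 * (g ⬝ᵥ Q *ᵥ g) * (((A - a) / (A + a)) ^ 2 * errE Q xs x) := by
      rw [h33, hE']
      have : 2 * (g ⬝ᵥ Q *ᵥ g) * (((A - a) / (A + a)) ^ 2 * ((g ⬝ᵥ C *ᵥ g) / 2)) =
          (g ⬝ᵥ Q *ᵥ g) * (g ⬝ᵥ C *ᵥ g) - (1 - ((A - a) / (A + a)) ^ 2) *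
            ((g ⬝ᵥ Q *ᵥ g) * (g ⬝ᵥ C *ᵥ g)) := by ring
      rw [this, hρ]
      linarith [hs]
    exact le_of_mul_le_mul_left key (by linarith)

/-- **AL07 (5.8): `f(x_{k+1}) - f(x*) ≤ ((1-r)/(1+r))² [f(x_k) - f(x*)]`, `r = a/A`** (smallest over
largest eigenvalue), for the quadratic with the exact steepest-descent step — "furthermore, if `f` is
a quadratic function then the inequality holds for all `k`".
[cite: AntoniouLu2007, §5.2.5 (5.8); LuenbergerYe2008, §7.6 (35)] -/
theorem steepestDescent_rate_ratio (hQ : Qᵀ = Q) (hC : Cᵀ = C) (hQC : Q * C = 1) (hCQ : C * Q = 1)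
    (ha0 : 0 < a) (haA : a ≤ A) (ha : ∀ v, a * (v ⬝ᵥ v) ≤ v ⬝ᵥ Q *ᵥ v)
    (hA : ∀ v, v ⬝ᵥ Q *ᵥ v ≤ A * (v ⬝ᵥ v)) (hxs : Q *ᵥ xs = b) (x : n → ℝ) {α : ℝ}
    (hα : α * ((Q *ᵥ x - b) ⬝ᵥ Q *ᵥ (Q *ᵥ x - b)) = (Q *ᵥ x - b) ⬝ᵥ (Q *ᵥ x - b)) :
    quadObj Q b (x - α • (Q *ᵥ x - b)) - quadObj Q b xs ≤
      ((1 - a / A) / (1 + a / A)) ^ 2 * (quadObj Q b x - quadObj Q b xs) := by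
  have hApos : 0 < A := lt_of_lt_of_le ha0 haA
  have hr : (1 - a / A) / (1 + a / A) = (A - a) / (A + a) := by
    rw [div_eq_div_iff (by positivity) (by positivity)]
    field_simp
  rw [hr, ← errE_eq_quadObj_sub hQ hxs, ← errE_eq_quadObj_sub hQ hxs]
  exact steepestDescent_rate hQ hC hQC hCQ ha0 haA ha hA hxs x hα

end Rate

end Literature.Analysis.Convex.SteepestDescentQuadraticRate
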